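import Summits.ResolutionOfSingularities.ResolutionOfSingularities.Theorems.WildQuotientsSummitReductionStubPairQuasiSplitNormalFormLemmas2
import HarnessLib

/-!
# `WildQuotients.SummitReduction` (stmt-ResolutionOfSingularities-16324), line `FramePerfect`, skeleton v8:
# stub `stub_pair_quasiSplitNormalForm` (N) — helper file 3: de Jong 1996, 3.3 at a QUASI-SPLIT point
# and the quasi-split nodal structure `𝒪̂_{X,x} ≅ κ(f x)⟦u, v, T⟧/(uv - ∏ Tᵢ^{νᵢ})`

Route `ResolutionOfSingularities/WildQuotients`, crux `SummitReduction`; sub-goals of the registered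
stub `stub_pair_quasiSplitNormalForm` of the line skeleton `Cruxes/SummitReduction/Lines/FramePerfect.lean`
(v8, lead c4). Worker file; continuation of `…StubPairQuasiSplitNormalFormLemmas2.lean` (2.23 at a
quasi-split point on Cohen coordinates over the residue field `κ(f x)`).

* `dvd_pow_of_quasiSplit` — de Jong 1996, 3.3: "By assumption we have `V(h) ⊂ V(t₁ ⋯ t_r)`", i.e.
  `h ∣ (t₁ ⋯ t_r)^N` in `Λ = K⟦T⟧` (the tree's `dvd_pow_of_not_smooth` verbatim — the residues
  `∂/∂u`, `∂/∂v` at `u = v = 0` kill `Fitt₁(Ω_{X/Y})_x` in `Λ/(h)` while `I(D)_{f x} ⊆ √Fitt₁` by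
  smoothness over `Y ∖ D` — the non-vanishing of `Fitt₁` being read off the quasi-split datum);
* `exists_formalNodeRing_equiv_of_cohen` — 3.3 assembled on given Cohen coordinates (unit absorbed,
  rebracketed), over any coefficient field `K`;
* `exists_formalNodeRing_equiv_of_quasiSplit` — THE QUASI-SPLIT NODAL STRUCTURE (the tree's
  `DeJong1996SplitNodalStructure_holds` without algebraic closedness, at any point carrying a
  quasi-split datum): `𝒪̂_{X,x} ≅ κ(f x)⟦u, v, T₁, …, T_m⟧/(uv - ∏ Tᵢ^{νᵢ})`, `νᵢ = 0` for `i ≥ r`,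
  `f^#(tᵢ) ↦ Tᵢ`.
-/

set_option linter.dupNamespace false

noncomputable section

open CategoryTheory CategoryTheory.Limits AlgebraicGeometry TopologicalSpace
open Literature.AlgebraicGeometry.Resolution
open Literature.AlgebraicGeometry
open IsLocalRing NodalDeformation Scheme.IdealSheafData

namespace Summit.ResolutionOfSingularities.ResolutionOfSingularities.Theorems

universe u

section Local

variable {k : Type u} [Field k] {X Y : Scheme.{u}} {f : X ⟶ Y} {g : Y ⟶ Spec (.of k)}
  {D : Set Y} {n : ℕ} {τ : Fin n → (Y ⟶ X)}

/-- **de Jong 1996, 3.3 at a quasi-split point: "By assumption we have `V(h) ⊂ V(t₁ ⋯ t_r)`" —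
`h` divides a power of the image of the local equation of `D`.** In the situation of
`exists_ringEquiv_nodeDeformationRing_cohen_of_quasiSplit` (`e : 𝒪̂_{X,x} ≅ Λ⟦u, v⟧/(uv - h)` over
Cohen coordinates `eA : 𝒪̂_{Y,f x} ≅ Λ`), if `I(D)_{f x} = (a₀)` then `h ∣ (eA â₀)^N` for some `N`.
The tree's `dvd_pow_of_not_smooth` verbatim (the residues `∂/∂u`, `∂/∂v` at `u = v = 0` kill
`Fitt₁(Ω_{X/Y})_x` in `Λ/(h)`, while `a₀ ∈ √Fitt₁(Ω_{X/Y})_x` by smoothness over `Y ∖ D`), except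
that `Fitt₁(Ω_{X/Y})_x ≠ 0` is read off the quasi-split datum: were it `0`, then
`𝔪_x = 𝔪_{f x}𝒪_{X,x}` (2.21) and the completed fibre ring `κ(f x)⟦u, v⟧/(uv)` would be the field
`κ(x)`, a domain. [cite: DeJong1996, 3.3, p. 63] -/
theorem dvd_pow_of_quasiSplit (hS : DeJong1996.SemiStablePair f g D τ) {x : X}
    (e₁ : AdicCompletion
        ((maximalIdeal (X.presheaf.stalk x)).map (Ideal.Quotient.mk
          ((maximalIdeal (Y.presheaf.stalk (f x))).map (f.stalkMap x).hom)))
        (X.presheaf.stalk x ⧸ (maximalIdeal (Y.presheaf.stalk (f x))).map (f.stalkMap x).hom) ≃+*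
      MvPowerSeries (Fin 2) (Y.presheaf.stalk (f x) ⧸ maximalIdeal (Y.presheaf.stalk (f x))) ⧸
        Ideal.span {(MvPowerSeries.X 0 * MvPowerSeries.X 1 :
          MvPowerSeries (Fin 2) (Y.presheaf.stalk (f x) ⧸ maximalIdeal (Y.presheaf.stalk (f x))))})
    {K : Type u} [Field K] {m : ℕ} {h : MvPowerSeries (Fin m) K}
    (eA : AdicCompletion (maximalIdeal (Y.presheaf.stalk (f x))) (Y.presheaf.stalk (f x)) ≃+*
        MvPowerSeries (Fin m) K)
    (e : AdicCompletion (maximalIdeal (X.presheaf.stalk x)) (X.presheaf.stalk x) ≃+*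
        DeJong1996.NodeDeformationRing (MvPowerSeries (Fin m) K) h)
    (hh : ¬ IsUnit h)
    (he : ∀ a, e (algebraMap _ _ ((f.stalkMap x).hom a)) =
      Ideal.Quotient.mk _ (MvPowerSeries.C (eA (algebraMap _ _ a))))
    (a₀ : Y.presheaf.stalk (f x))
    (hI : stalkIdeal (vanishingIdeal ⟨D, hS.isStrictNormalCrossingsDivisor.isClosed⟩) (f x) =
      Ideal.span {a₀}) :
    ∃ N : ℕ, h ∣ (eA (algebraMap _ _ a₀)) ^ N := by
  classical
  haveI := hS.isIntegral
  haveI : IsNoetherian X := DeJong1996.isNoetherian_of_isProjectiveOver _ hS.isProjectiveOver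
  letI algAB : Algebra (Y.presheaf.stalk (f x)) (X.presheaf.stalk x) := (f.stalkMap x).hom.toAlgebra
  -- the local rings `M = Λ⟦u, v⟧/(uv - h)` and `C = Λ/(h)`
  have hhmax : h ∈ maximalIdeal (MvPowerSeries (Fin m) K) := hh
  haveI hMloc : IsLocalRing (DeJong1996.NodeDeformationRing (MvPowerSeries (Fin m) K) h) :=
    DeJong1996.NodeDeformationRing.isLocalRing hhmax
  have hspan : Ideal.span {h} ≠ ⊤ := by rwa [Ne, Ideal.span_singleton_eq_top]
  haveI hCnt : Nontrivial (MvPowerSeries (Fin m) K ⧸ Ideal.span {h}) :=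
    Ideal.Quotient.nontrivial_iff.mpr hspan
  haveI hCloc : IsLocalRing (MvPowerSeries (Fin m) K ⧸ Ideal.span {h}) :=
    IsLocalRing.of_surjective' (Ideal.Quotient.mk _) Ideal.Quotient.mk_surjective
  haveI : IsLocalHom e.toRingHom := IsLocalHom.of_surjective _ e.surjective
  haveI : IsLocalHom (DeJong1996.NodeDeformationRing.toBaseQuotient (MvPowerSeries (Fin m) K) h) :=
    IsLocalHom.of_surjective _ (DeJong1996.NodeDeformationRing.toBaseQuotient_surjective h)
  -- the ring maps `φ : 𝒪_{X,x} → M`, `φ' : 𝒪_{X,x} → C`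
  let φ : X.presheaf.stalk x →+* DeJong1996.NodeDeformationRing (MvPowerSeries (Fin m) K) h :=
    e.toRingHom.comp (algebraMap (X.presheaf.stalk x)
      (AdicCompletion (maximalIdeal (X.presheaf.stalk x)) (X.presheaf.stalk x)))
  let φ' : X.presheaf.stalk x →+* MvPowerSeries (Fin m) K ⧸ Ideal.span {h} :=
    (DeJong1996.NodeDeformationRing.toBaseQuotient _ h).comp φ
  letI algBC : Algebra (X.presheaf.stalk x) (MvPowerSeries (Fin m) K ⧸ Ideal.span {h}) :=
    φ'.toAlgebra
  letI algAC : Algebra (Y.presheaf.stalk (f x)) (MvPowerSeries (Fin m) K ⧸ Ideal.span {h}) :=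
    (φ'.comp (f.stalkMap x).hom).toAlgebra
  haveI : IsScalarTower (Y.presheaf.stalk (f x)) (X.presheaf.stalk x)
      (MvPowerSeries (Fin m) K ⧸ Ideal.span {h}) :=
    IsScalarTower.of_algebraMap_eq (fun _ => rfl)
  have heφ : ∀ a, φ ((f.stalkMap x).hom a) =
      Ideal.Quotient.mk _ (MvPowerSeries.C (eA (algebraMap _ _ a))) := he
  -- the residues pulled back to `𝒪_{X,x}`: two `𝒪_{Y,f x}`-derivations
  let δ : Fin 2 → Derivation (Y.presheaf.stalk (f x)) (X.presheaf.stalk x)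
      (MvPowerSeries (Fin m) K ⧸ Ideal.span {h}) := fun i =>
    Derivation.ofRingHomOfMapAlgebraMap φ (fun _ _ => rfl)
      (DeJong1996.NodeDeformationRing.coeffDerivation h i)
      (fun a => by
        change DeJong1996.NodeDeformationRing.coeffDerivation h i (φ ((f.stalkMap x).hom a)) = 0
        rw [heφ, DeJong1996.NodeDeformationRing.coeffDerivation_mk_C])
  have hδ : ∀ i b, δ i b = DeJong1996.NodeDeformationRing.coeffDerivation h i (φ b) :=
    fun _ _ => rfl
  -- on `e(𝔪̂²) ⊆ 𝔪_M²` the residues take values in `𝔪_C`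
  have hsq : ∀ (i : Fin 2)
      (w : AdicCompletion (maximalIdeal (X.presheaf.stalk x)) (X.presheaf.stalk x)),
      w ∈ (maximalIdeal _) ^ 2 →
        DeJong1996.NodeDeformationRing.coeffDerivation h i (e w) ∈
          maximalIdeal (MvPowerSeries (Fin m) K ⧸ Ideal.span {h}) := by
    intro i w hw
    have hew : e w ∈
        (maximalIdeal (DeJong1996.NodeDeformationRing (MvPowerSeries (Fin m) K) h)) ^ 2 := by
      have h1 : e.toRingHom w ∈ ((maximalIdeal _) ^ 2).map e.toRingHom := Ideal.mem_map_of_mem _ hw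
      rw [Ideal.map_pow] at h1
      refine Ideal.pow_right_mono ?_ 2 h1
      exact Ideal.map_le_iff_le_comap.mpr fun a ha => map_nonunit e.toRingHom a ha
    rw [sq] at hew
    refine Submodule.mul_induction_on hew (fun p hp q hq => ?_) (fun p q hp hq => ?_)
    · rw [Derivation.leibniz, Algebra.smul_def, Algebra.smul_def,
        DeJong1996.NodeDeformationRing.algebraMap_baseQuotient]
      exact Ideal.add_mem _ (Ideal.mul_mem_right _ _ (map_nonunit _ p hp))
        (Ideal.mul_mem_right _ _ (map_nonunit _ q hq))
    · rw [map_add]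
      exact Ideal.add_mem _ hp hq
  -- lifts `b_u`, `b_v ∈ 𝒪_{X,x}` of `u`, `v` modulo `𝔪̂²`
  obtain ⟨bu, hbu⟩ := AdicCompletion.exists_sub_algebraMap_mem_maximalIdeal_sq
    (e.symm (Ideal.Quotient.mk _ (MvPowerSeries.X 0)))
  obtain ⟨bv, hbv⟩ := AdicCompletion.exists_sub_algebraMap_mem_maximalIdeal_sq
    (e.symm (Ideal.Quotient.mk _ (MvPowerSeries.X 1)))
  set zu := e.symm (Ideal.Quotient.mk _ (MvPowerSeries.X 0)) - algebraMap _ _ bu with hzu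
  set zv := e.symm (Ideal.Quotient.mk _ (MvPowerSeries.X 1)) - algebraMap _ _ bv with hzv
  have hφbu : φ bu = Ideal.Quotient.mk _ (MvPowerSeries.X 0) - e zu := by
    change e (algebraMap _ _ bu) = _
    rw [hzu, map_sub, RingEquiv.apply_symm_apply, sub_sub_cancel]
  have hφbv : φ bv = Ideal.Quotient.mk _ (MvPowerSeries.X 1) - e zv := by
    change e (algebraMap _ _ bv) = _
    rw [hzv, map_sub, RingEquiv.apply_symm_apply, sub_sub_cancel]
  -- the values of the residues at the lifts: the identity matrix modulo `𝔪_C`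
  set a := DeJong1996.NodeDeformationRing.coeffDerivation h 0 (e zu) with ha
  set b := DeJong1996.NodeDeformationRing.coeffDerivation h 1 (e zu) with hb
  set c := DeJong1996.NodeDeformationRing.coeffDerivation h 0 (e zv) with hc
  set d := DeJong1996.NodeDeformationRing.coeffDerivation h 1 (e zv) with hd
  have hv00 : δ 0 bu = 1 - a := by
    rw [hδ, hφbu, map_sub, DeJong1996.NodeDeformationRing.coeffDerivation_mk_X, if_pos rfl]
  have hv10 : δ 1 bu = 0 - b := by
    rw [hδ, hφbu, map_sub, DeJong1996.NodeDeformationRing.coeffDerivation_mk_X, if_neg (by decide)]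
  have hv01 : δ 0 bv = 0 - c := by
    rw [hδ, hφbv, map_sub, DeJong1996.NodeDeformationRing.coeffDerivation_mk_X, if_neg (by decide)]
  have hv11 : δ 1 bv = 1 - d := by
    rw [hδ, hφbv, map_sub, DeJong1996.NodeDeformationRing.coeffDerivation_mk_X, if_pos rfl]
  -- hence a unit determinant
  have hdet : IsUnit (δ 0 bu * δ 1 bv - δ 1 bu * δ 0 bv) := by
    have hw : a + d - a * d + b * c ∈ maximalIdeal (MvPowerSeries (Fin m) K ⧸ Ideal.span {h}) :=
      Ideal.add_mem _ (Ideal.sub_mem _ (Ideal.add_mem _ (hsq 0 zu hbu) (hsq 1 zv hbv))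
        (Ideal.mul_mem_left _ _ (hsq 1 zv hbv))) (Ideal.mul_mem_left _ _ (hsq 0 zv hbv))
    have hexp : δ 0 bu * δ 1 bv - δ 1 bu * δ 0 bv = 1 - (a + d - a * d + b * c) := by
      rw [hv00, hv10, hv01, hv11]
      ring
    rw [hexp]
    by_contra hnu
    have h1 : (1 : MvPowerSeries (Fin m) K ⧸ Ideal.span {h}) ∈ maximalIdeal _ := by
      have := Ideal.add_mem _ ((mem_maximalIdeal _).mpr hnu) hw
      rwa [sub_add_cancel] at this
    exact (maximalIdeal.isMaximal _).ne_top (Ideal.eq_top_of_isUnit_mem _ h1 isUnit_one)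
  -- so `Fitt₁(Ω_{X/Y})_x` dies in `C = Λ/(h)`
  have hF : (Scheme.Hom.singFittingIdeal f x).map φ' = ⊥ :=
    Module.map_fittingIdeal_kaehlerDifferential_one_eq_bot_of_derivation (δ 0) (δ 1) bu bv hdet
  -- `Fitt₁(Ω_{X/Y})_x ≠ 0`: else `𝔪_x = 𝔪_{f x} 𝒪_{X,x}` (2.21) and the completed fibre ring, the
  -- formal node `K⟦u, v⟧/(uv)`, would be the field `K(x)`
  have hFne : Scheme.Hom.singFittingIdeal f x ≠ ⊥ := by
    intro hF0
    have hun := (DeJong1996SingUnramified_holds X Y f hS.isSemiStableCurve x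
      (by rw [hF0]; exact bot_ne_top)).1
    rw [hF0, bot_sup_eq] at hun
    have heq : (maximalIdeal (Y.presheaf.stalk (f x))).map (f.stalkMap x).hom =
        maximalIdeal (X.presheaf.stalk x) :=
      le_antisymm (DeJong1996.map_maximalIdeal_stalkMap_le f x) hun
    exact map_maximalIdeal_ne_of_quasiSplit (f.stalkMap x).hom e₁ heq
  -- `I(D)_{f x} 𝒪_{X,x} ⊆ √Fitt₁(Ω_{X/Y})_x` (smoothness over `Y ∖ D`)
  have hrad : (stalkIdeal (vanishingIdeal ⟨D, hS.isStrictNormalCrossingsDivisor.isClosed⟩)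
      (f x)).map (f.stalkMap x).hom ≤ (Scheme.Hom.singFittingIdeal f x).radical := by
    rw [Ideal.radical_eq_sInf]
    refine le_sInf ?_
    rintro P ⟨hFP, hP⟩
    haveI := hP
    refine hS.map_stalkIdeal_le_of_singFittingIdeal_le P hFP (fun s hs => ?_)
    obtain ⟨q, hqF, hq0⟩ := Submodule.exists_mem_ne_zero_of_ne_bot hFne
    rcases mul_eq_zero.mp (hs q hqF) with h0 | h0
    · rw [h0]
      exact P.zero_mem
    · exact (hq0 h0).elim
  have ha₀ : (f.stalkMap x).hom a₀ ∈ (Scheme.Hom.singFittingIdeal f x).radical := by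
    refine hrad (Ideal.mem_map_of_mem _ ?_)
    rw [hI]
    exact Ideal.mem_span_singleton_self a₀
  obtain ⟨N, hN⟩ := Ideal.mem_radical_iff.mp ha₀
  refine ⟨N, ?_⟩
  have h0 : φ' (((f.stalkMap x).hom a₀) ^ N) = 0 := by
    have h1 : φ' (((f.stalkMap x).hom a₀) ^ N) ∈ (Scheme.Hom.singFittingIdeal f x).map φ' :=
      Ideal.mem_map_of_mem _ hN
    rwa [hF, Ideal.mem_bot] at h1
  have hφ'a : φ' ((f.stalkMap x).hom a₀) =
      Ideal.Quotient.mk (Ideal.span {h}) (eA (algebraMap _ _ a₀)) := by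
    change DeJong1996.NodeDeformationRing.toBaseQuotient _ h (φ ((f.stalkMap x).hom a₀)) = _
    rw [heφ, DeJong1996.NodeDeformationRing.toBaseQuotient_mk_C]
  rw [map_pow, hφ'a, ← map_pow, Ideal.Quotient.eq_zero_iff_mem, Ideal.mem_span_singleton] at h0
  exact h0

end Local

/-! ## The quasi-split nodal structure -/

section Local2

variable {k : Type u} [Field k] {X Y : Scheme.{u}} {f : X ⟶ Y} {g : Y ⟶ Spec (.of k)}
  {D : Set Y} {n : ℕ} {τ : Fin n → (Y ⟶ X)}

/-- **3.3 assembled on given Cohen coordinates** (the tree's `DeJong1996SplitNodalStructure_holds`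
verbatim, over any coefficient field `K`): from `e : 𝒪̂_{X,x} ≅ Λ⟦u, v⟧/(uv - h)`, `Λ = K⟦T⟧`,
`eA : 𝒪̂_{Y,f x} ≅ Λ` with `tᵢ ↦ Tᵢ`, compatible, and `I(D)_{f x} = (∏_{i<r} tᵢ)`: `h ∣ (∏_{i<r} Tᵢ)^N`
(`dvd_pow_of_quasiSplit`), so `h = ε ∏_{i<r} Tᵢ^{nᵢ}` (the `Tᵢ` are prime), `ε` is absorbed into `u`
(`absorbUnit`) and the ring rebracketed (`toFormalNodeRing`):
`𝒪̂_{X,x} ≅ K⟦u, v, T⟧/(uv - ∏ Tᵢ^{νᵢ})`, `νᵢ = 0` for `i ≥ r`, `f^#(tᵢ) ↦ Tᵢ`.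
[cite: DeJong1996, 3.3, p. 63] -/
theorem exists_formalNodeRing_equiv_of_cohen (hS : DeJong1996.SemiStablePair f g D τ) {x : X}
    (e₁ : AdicCompletion
        ((maximalIdeal (X.presheaf.stalk x)).map (Ideal.Quotient.mk
          ((maximalIdeal (Y.presheaf.stalk (f x))).map (f.stalkMap x).hom)))
        (X.presheaf.stalk x ⧸ (maximalIdeal (Y.presheaf.stalk (f x))).map (f.stalkMap x).hom) ≃+*
      MvPowerSeries (Fin 2) (Y.presheaf.stalk (f x) ⧸ maximalIdeal (Y.presheaf.stalk (f x))) ⧸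
        Ideal.span {(MvPowerSeries.X 0 * MvPowerSeries.X 1 :
          MvPowerSeries (Fin 2) (Y.presheaf.stalk (f x) ⧸ maximalIdeal (Y.presheaf.stalk (f x))))})
    {K : Type u} [Field K] {m r : ℕ} (t : Fin m → Y.presheaf.stalk (f x))
    (hI : stalkIdeal (vanishingIdeal ⟨D, hS.isStrictNormalCrossingsDivisor.isClosed⟩) (f x) =
      Ideal.span {∏ i ∈ Finset.univ.filter (fun i : Fin m => i.val < r), t i})
    {h : MvPowerSeries (Fin m) K}
    (eA : AdicCompletion (maximalIdeal (Y.presheaf.stalk (f x))) (Y.presheaf.stalk (f x)) ≃+*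
        MvPowerSeries (Fin m) K)
    (e : AdicCompletion (maximalIdeal (X.presheaf.stalk x)) (X.presheaf.stalk x) ≃+*
        DeJong1996.NodeDeformationRing (MvPowerSeries (Fin m) K) h)
    (hh : ¬ IsUnit h) (heA : ∀ i, eA (algebraMap _ _ (t i)) = MvPowerSeries.X i)
    (he : ∀ a, e (algebraMap _ _ ((f.stalkMap x).hom a)) =
      Ideal.Quotient.mk _ (MvPowerSeries.C (eA (algebraMap _ _ a)))) :
    ∃ (ν : Fin m → ℕ) (e' : AdicCompletion (maximalIdeal (X.presheaf.stalk x))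
        (X.presheaf.stalk x) ≃+* DeJong1996.FormalNodeRing K m ν),
      (∀ i : Fin m, r ≤ i.val → ν i = 0) ∧
        ∀ i : Fin m, e' (algebraMap _ _ ((f.stalkMap x).hom (t i))) =
          Ideal.Quotient.mk _ (MvPowerSeries.X (Sum.inr i)) := by
  classical
  -- 3.3: `h ∣ (∏_{i<r} Tᵢ)^N`
  set s : Finset (Fin m) := Finset.univ.filter (fun i : Fin m => i.val < r) with hs
  obtain ⟨N, hN⟩ := dvd_pow_of_quasiSplit hS e₁ eA e hh he (∏ i ∈ s, t i) hI
  have hprod : eA (algebraMap _ _ (∏ i ∈ s, t i)) =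
      ∏ i ∈ s, (MvPowerSeries.X i : MvPowerSeries (Fin m) K) := by
    rw [map_prod, map_prod]
    exact Finset.prod_congr rfl fun i _ => heA i
  rw [hprod, ← Finset.prod_pow] at hN
  -- `h = ε ∏_{i<r} Tᵢ^{nᵢ}`, the `Tᵢ` being prime elements of the domain `Λ`
  haveI : IsDomain (MvPowerSeries (Fin m) K) := NoZeroDivisors.to_isDomain _
  obtain ⟨nn, ε, hfac⟩ := exists_eq_units_mul_prod_pow_of_dvd_prod_pow s
    (fun i => (MvPowerSeries.X i : MvPowerSeries (Fin m) K)) (fun i _ => MvPowerSeries.prime_X' K i)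
    N hN
  -- the exponents on `Fin m`, vanishing beyond `r`
  let ν : Fin m → ℕ := fun i => if i.val < r then nn i else 0
  have hm₀ : ∏ i ∈ s, (MvPowerSeries.X i : MvPowerSeries (Fin m) K) ^ nn i =
      ∏ i, MvPowerSeries.X i ^ ν i := by
    rw [hs, Finset.prod_filter]
    refine Finset.prod_congr rfl fun i _ => ?_
    simp only [ν]
    split_ifs <;> simp
  have hrel : Ideal.span {DeJong1996.nodeDeformationRelation (MvPowerSeries (Fin m) K) h} =
      Ideal.span {DeJong1996.nodeDeformationRelation (MvPowerSeries (Fin m) K)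
        ((ε : MvPowerSeries (Fin m) K) * ∏ i ∈ s, MvPowerSeries.X i ^ nn i)} := by
    rw [← hfac]
  have hrel' : Ideal.span {DeJong1996.nodeDeformationRelation (MvPowerSeries (Fin m) K)
        (∏ i ∈ s, MvPowerSeries.X i ^ nn i)} =
      Ideal.span {DeJong1996.nodeDeformationRelation (MvPowerSeries (Fin m) K)
        (∏ i, MvPowerSeries.X i ^ ν i)} := by
    rw [hm₀]
  -- the isomorphism: 2.23, `ε` absorbed into `u`, rebracketed
  refine ⟨ν, (((e.trans (Ideal.quotEquivOfEq hrel)).trans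
      (DeJong1996.NodeDeformationRing.absorbUnit ε _)).trans (Ideal.quotEquivOfEq hrel')).trans
      (DeJong1996.NodeDeformationRing.toFormalNodeRing K m ν), fun i hi => ?_, fun i => ?_⟩
  · simp only [ν]
    rw [if_neg (by omega)]
  · rw [RingEquiv.trans_apply, RingEquiv.trans_apply, RingEquiv.trans_apply,
      RingEquiv.trans_apply, he, heA, Ideal.quotEquivOfEq_mk,
      DeJong1996.NodeDeformationRing.absorbUnit_mk_C, Ideal.quotEquivOfEq_mk,
      DeJong1996.NodeDeformationRing.toFormalNodeRing_mk_C_X]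

end Local2

/-- **de Jong 1996, 2.23 with 3.3 at a QUASI-SPLIT point of `Sing(f)`, over an arbitrary field**
(the tree's `DeJong1996SplitNodalStructure_holds` without algebraic closedness). For the curve
`f : X → Y` of a pair in Situation 4.23 over any field `k`, a point `x` carrying a quasi-split datum
`(𝒪_{X,x}/𝔪_{f x}𝒪_{X,x})^ ≅ κ(f x)⟦u, v⟧/(uv)` over `κ(f x)` (de Jong 1997, 5.7), and a regular
system of parameters `t₁, …, t_m` of `𝒪_{Y,f x}` with `I(D)_{f x} = (∏_{i<r} tᵢ)`: there are
exponents `νᵢ ≥ 0`, vanishing for `i ≥ r`, and a ring isomorphism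
`𝒪̂_{X,x} ≅ κ(f x)⟦u, v, T₁, …, T_m⟧/(uv - ∏ Tᵢ^{νᵢ})` (`DeJong1996.FormalNodeRing`) sending the
image of `f^#(tᵢ)` to `Tᵢ`. Assembly as in the tree: 2.23 on Cohen coordinates over `κ(f x)`
(`exists_ringEquiv_nodeDeformationRing_cohen_of_quasiSplit`); 3.3 (`dvd_pow_of_quasiSplit`:
`h ∣ (∏_{i<r} Tᵢ)^N`, so `h = ε ∏_{i<r} Tᵢ^{nᵢ}`, the `Tᵢ` being prime); "we change `Q` into
`ε⁻¹ Q`" (`absorbUnit`); rebracketing (`toFormalNodeRing`).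
[cite: DeJong1996, 2.23 and 3.3, pp. 61–63] [cite: DeJong1997, 5.7, p. 614] -/
theorem exists_formalNodeRing_equiv_of_quasiSplit {k : Type u} [Field k] {X Y : Scheme.{u}}
    {f : X ⟶ Y} {g : Y ⟶ Spec (.of k)} {D : Set Y} {n : ℕ} {τ : Fin n → (Y ⟶ X)}
    (hS : DeJong1996.SemiStablePair f g D τ) {x : X}
    (e₁ : AdicCompletion
        ((maximalIdeal (X.presheaf.stalk x)).map (Ideal.Quotient.mk
          ((maximalIdeal (Y.presheaf.stalk (f x))).map (f.stalkMap x).hom)))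
        (X.presheaf.stalk x ⧸ (maximalIdeal (Y.presheaf.stalk (f x))).map (f.stalkMap x).hom) ≃+*
      MvPowerSeries (Fin 2) (Y.presheaf.stalk (f x) ⧸ maximalIdeal (Y.presheaf.stalk (f x))) ⧸
        Ideal.span {(MvPowerSeries.X 0 * MvPowerSeries.X 1 :
          MvPowerSeries (Fin 2) (Y.presheaf.stalk (f x) ⧸ maximalIdeal (Y.presheaf.stalk (f x))))})
    (he₁ : e₁.toRingHom.comp ((algebraMap (X.presheaf.stalk x ⧸
        (maximalIdeal (Y.presheaf.stalk (f x))).map (f.stalkMap x).hom) _).comp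
        (Ideal.quotientMap ((maximalIdeal (Y.presheaf.stalk (f x))).map (f.stalkMap x).hom)
          (f.stalkMap x).hom Ideal.le_comap_map)) =
      algebraMap (Y.presheaf.stalk (f x) ⧸ maximalIdeal (Y.presheaf.stalk (f x))) _)
    {m r : ℕ} (t : Fin m → Y.presheaf.stalk (f x))
    (ht : Ideal.span (Set.range t) = maximalIdeal (Y.presheaf.stalk (f x)))
    (hm : ringKrullDim (Y.presheaf.stalk (f x)) = m)
    (hI : stalkIdeal (vanishingIdeal ⟨D, hS.isStrictNormalCrossingsDivisor.isClosed⟩) (f x) =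
      Ideal.span {∏ i ∈ Finset.univ.filter (fun i : Fin m => i.val < r), t i}) :
    ∃ (ν : Fin m → ℕ) (e : AdicCompletion (maximalIdeal (X.presheaf.stalk x))
        (X.presheaf.stalk x) ≃+*
          DeJong1996.FormalNodeRing (ResidueField (Y.presheaf.stalk (f x))) m ν),
      (∀ i : Fin m, r ≤ i.val → ν i = 0) ∧
        ∀ i : Fin m, e (algebraMap _ _ ((f.stalkMap x).hom (t i))) =
          Ideal.Quotient.mk _ (MvPowerSeries.X (Sum.inr i)) := by
  -- 2.23 on Cohen coordinates over the residue field, then 3.3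
  obtain ⟨h, eA, e, hh, heA, he⟩ :=
    exists_ringEquiv_nodeDeformationRing_cohen_of_quasiSplit hS e₁ he₁ t ht hm
  exact exists_formalNodeRing_equiv_of_cohen hS e₁ t hI eA e hh heA he

end Summit.ResolutionOfSingularities.ResolutionOfSingularities.Theorems

end
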